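import Summits.QuantumFields.YangMills.Theorems.AlphaInputsT3ACv3LinearLiftProfileLip
import HarnessLib

/-!
# `AlphaInputsT3ACv3LinearLiftProfileLipIds` — (LL) STEP L1-Lip (continued): THE FOUR EXACT IDENTITIES, THE BOUNDS AND THE LIPSCHITZ ROW OF THE PROFILES `σ_L`, `τ_L`
# of `AlphaInputsT3ACv3LinearLiftProfileLip` — cell `ym3-torus`, width seat `ym3-torus-px19` (g3), line «SYM-CENTRE» row (R3)

By-name twin of `AlphaInputsT3ACv3LinearLiftProfileIds` (seat `ym-ust-19936-w2` g0) for the Lipschitz profile `ρ_L` (same support `[−2p, 2p]`, same weight identity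
`weightSumL_eq`), proofs verbatim with `ρ ↦ ρ_L`, plus the one new row:
* §3 (i) `cellSum_sigmaL`; (ii) `pou_sigmaL`; (iii) `sigmaL_succ_sub` (the chain identity); (iv) `segTL_eq` (exact transported-segment means).
* §4 (v) `abs_tauL_le` (`|τ_L| ≤ 18/n`), `tauL_eq_zero`, `abs_sigmaL_le` (`|σ_L| ≤ 18`), `sigmaL_eq_zero`, `abs_sigmaL_succ_sub_le` (`|Δσ_L| ≤ 36/n`), and
  ★ (vi) `abs_tauL_succ_sub_le` : `|τ_L(s+1) − τ_L(s)| ≤ 110/n²` — THE ROW THE STEP PROFILE LACKS (it makes the spread fine curl `S²(curl A)` Lipschitz at scale `n`,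
  i.e. `|∂*curl| ≤ C·ε/n³`, the divergence clause of a regular representative).
HONEST FRAMING.  Elementary real∕integer bookkeeping; nothing of [Balaban1985UV3]∕[Balaban1985Variational]∕[Balaban1987RG1] is asserted; count-neutral helper toward the
symmetric-centre row of the EX display (`--supports stmt-QuantumFields-19200`); registry untouched.  YM₃ on the torus is a RUNG of the programme, not the Clay problem; no claim
about d = 4, infinite volume or a mass gap.

References: T. Bałaban, Commun. Math. Phys. 109 (1987) 249–301 [Balaban1987RG1] ((0.4) p.253); Commun. Math. Phys. 102 (1985) 277–309 [Balaban1985Variational] (Thm 1 (8) p.279).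
-/

set_option autoImplicit false

noncomputable section

namespace Summit.QuantumFields.YangMills.Theorems.LinearLiftProfileLip

open Finset
open Summit.QuantumFields.YangMills.Theorems.LinearLiftProfile

variable (h : ℕ)

/-! ## §3 The four exact identities -/

/-- **(i) EXACT CELL SUMS**: `Σ_{|t| ≤ h} σ(t + jn) = n·δ_{j0}` — the block average of the spread of a coarse 0-form returns the 0-form. [folklore] -/
theorem cellSum_sigmaL (j : ℤ) : ∑ t ∈ Icc (-(h : ℤ)) h, sigmaL h (t + j * side h) = if j = 0 then (side h : ℝ) else 0 := by
  unfold sigmaL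
  rw [← mul_sum, sum_comm]
  have e : ∀ u ∈ rsupp h, ∑ t ∈ Icc (-(h : ℤ)) h, rhoL h u * box h (t + j * side h - u) = rhoL h u * (wt h j u : ℝ) := by
    intro u _
    rw [← mul_sum]
    congr 1
    have e1 : ∑ t ∈ Icc (-(h : ℤ)) h, box h (t + j * side h - u) = ∑ t ∈ Icc (-(h : ℤ)) h, box h (t + (j * side h - u)) :=
      sum_congr rfl fun t _ => by rw [add_sub_assoc]
    rw [e1, sum_box_shift]
    rfl
  rw [sum_congr rfl e, weightSumL_eq]
  split_ifs
  · rw [pow_two, ← mul_assoc, inv_mul_cancel₀ (side_real_pos h).ne', one_mul]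
  · rw [mul_zero]

/-- **(ii) PARTITION OF UNITY**: `σ(s − n) + σ(s) + σ(s + n) = 1` for `|s| ≤ h` (only the two neighbouring cells' profiles overlap a cell). [folklore] -/
theorem pou_sigmaL (s : ℤ) (hs : -(h : ℤ) ≤ s ∧ s ≤ h) : sigmaL h (s - side h) + sigmaL h s + sigmaL h (s + side h) = 1 := by
  unfold sigmaL
  rw [← mul_add, ← mul_add, ← sum_add_distrib, ← sum_add_distrib]
  have e : ∀ u ∈ rsupp h, rhoL h u * box h (s - side h - u) + rhoL h u * box h (s - u) + rhoL h u * box h (s + side h - u) = rhoL h u := by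
    intro u hu
    rw [mem_rsupp] at hu
    rw [← mul_add, ← mul_add]
    have h3 := box_three h (s - u) (by constructor <;> omega)
    rw [show s - (side h : ℤ) - u = s - u - side h by ring, show s + (side h : ℤ) - u = s - u + side h by ring, h3, mul_one]
  rw [sum_congr rfl e, sum_rhoL, inv_mul_cancel₀ (side_real_pos h).ne']

/-- **(iii) THE CHAIN IDENTITY**: `σ(s+1) − σ(s) = τ(s+n) − τ(s)` — the discrete derivative of the 0-form profile is the coarse difference of the 1-form profile
(whence `d ∘ S⁰ = S¹ ∘ d` and `curl ∘ S¹ = S² ∘ curl` for the tensor spreading). [folklore] -/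
theorem sigmaL_succ_sub (s : ℤ) : sigmaL h (s + 1) - sigmaL h s = tauL h (s + side h) - tauL h s := by
  unfold sigmaL tauL
  rw [← mul_sub, ← mul_sub, ← sum_sub_distrib]
  congr 1
  have e : ∀ u ∈ rsupp h, rhoL h u * box h (s + 1 - u) - rhoL h u * box h (s - u) =
      (if s + (h : ℤ) + 1 = u then rhoL h u else 0) - (if s - (h : ℤ) = u then rhoL h u else 0) := by
    intro u _
    rw [← mul_sub, show s + 1 - u = s - u + 1 by ring, box_succ_sub]
    by_cases h1 : s + (h : ℤ) + 1 = u
    · rw [if_pos h1, if_pos (by omega), if_neg (by omega), if_neg (by omega)]; ring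
    · rw [if_neg h1, if_neg (by omega)]
      by_cases h2 : s - (h : ℤ) = u
      · rw [if_pos h2, if_pos (by omega)]; ring
      · rw [if_neg h2, if_neg (by omega)]; ring
  rw [sum_congr rfl e, sum_sub_distrib, sum_ite_eq, sum_ite_eq]
  have hn := side_int h
  rw [show s + (side h : ℤ) - h = s + h + 1 by rw [hn]; ring]
  congr 1
  · split_ifs with hm
    · rfl
    · exact (rhoL_eq_zero h (by rwa [mem_rsupp] at hm)).symm
  · split_ifs with hm
    · rfl
    · exact (rhoL_eq_zero h (by rwa [mem_rsupp] at hm)).symm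

/-- The transported-segment mean of the `τ_L`-profile of bond `j` seen from bond `0`: `T(j) = (1/n) Σ_{|t| ≤ h} Σ_{m<n} τ(t + m − jn)`. [folklore] -/
def segTL (j : ℤ) : ℝ := ((side h : ℝ))⁻¹ * ∑ t ∈ Icc (-(h : ℤ)) h, ∑ m ∈ range (side h), tauL h (t + m - j * side h)

/-- Telescoping the chain identity along a segment: `T(j−1) − T(j) = δ_{j1} − δ_{j0}`. [folklore] -/
theorem segTL_pred_sub (j : ℤ) : segTL h (j - 1) - segTL h j = (if j = 1 then 1 else 0) - (if j = 0 then 1 else 0) := by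
  unfold segTL
  rw [← mul_sub, ← sum_sub_distrib]
  have e : ∀ t ∈ Icc (-(h : ℤ)) h,
      (∑ m ∈ range (side h), tauL h (t + m - (j - 1) * side h)) - ∑ m ∈ range (side h), tauL h (t + m - j * side h)
        = sigmaL h (t + (1 - j) * side h) - sigmaL h (t + (-j) * side h) := by
    intro t _
    rw [← sum_sub_distrib]
    have hm : ∀ m : ℕ, tauL h (t + m - (j - 1) * side h) - tauL h (t + m - j * side h)
        = sigmaL h (t - j * side h + ((m + 1 : ℕ) : ℤ)) - sigmaL h (t - j * side h + (m : ℤ)) := by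
      intro m
      have hc := sigmaL_succ_sub h (t + m - j * side h)
      rw [show t + (m : ℤ) - (j - 1) * (side h : ℤ) = t + m - j * side h + side h by ring, ← hc]
      congr 2 <;> push_cast <;> ring
    simp_rw [hm]
    rw [sum_range_sub (fun m => sigmaL h (t - j * side h + (m : ℤ)))]
    congr 2 <;> push_cast <;> ring
  rw [sum_congr rfl e, sum_sub_distrib, cellSum_sigmaL h (1 - j), cellSum_sigmaL h (-j)]
  have hn0 := (side_real_pos h).ne'
  by_cases hj1 : j = 1
  · subst hj1
    rw [if_pos (by norm_num), if_neg (by norm_num), if_pos rfl, if_neg (by norm_num), sub_zero, sub_zero, inv_mul_cancel₀ hn0]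
  · by_cases hj0 : j = 0
    · subst hj0
      rw [if_neg (by norm_num), if_pos (by norm_num), if_neg hj1, if_pos rfl, zero_sub, zero_sub, mul_neg, inv_mul_cancel₀ hn0]
    · rw [if_neg (by omega), if_neg (by omega), if_neg hj1, if_neg hj0]; ring

/-- For `j ≥ 2` every profile value in `T(j)` vanishes (the segment stays a whole cell away from the support of `τ(· − jn)`). [folklore] -/
theorem segTL_eq_zero_of_two_le {j : ℤ} (hj : 2 ≤ j) : segTL h j = 0 := by
  unfold segTL
  have hn := side_int h; have h2 := two_prad_le h
  have hmul : 2 * (side h : ℤ) ≤ j * (side h : ℤ) := by nlinarith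
  rw [sum_eq_zero, mul_zero]
  intro t ht
  rw [mem_Icc] at ht
  refine sum_eq_zero fun m hmr => ?_
  rw [mem_range] at hmr
  have hm' : (m : ℤ) < side h := by exact_mod_cast hmr
  unfold tauL
  rw [rhoL_eq_zero h ?_, mul_zero]
  generalize j * (side h : ℤ) = J at hmul ⊢
  omega

/-- **(iv) EXACT SEGMENT MEANS**: `T(j) = δ_{j0}` — the transported-segment mean over a block of the spread of a coarse 1-form returns the 1-form. [folklore] -/
theorem segTL_eq (j : ℤ) : segTL h j = if j = 0 then 1 else 0 := by
  have htwo : ∀ j : ℤ, 2 ≤ j → segTL h j = 0 := fun j hj => segTL_eq_zero_of_two_le h hj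
  have e2 := segTL_pred_sub h 2
  rw [if_neg (by norm_num), if_neg (by norm_num), show (2 : ℤ) - 1 = 1 by norm_num] at e2
  have h1 : segTL h 1 = 0 := by linarith [htwo 2 le_rfl]
  have e1 := segTL_pred_sub h 1
  rw [if_pos rfl, if_neg (by norm_num), show (1 : ℤ) - 1 = 0 by norm_num] at e1
  have h0 : segTL h 0 = 1 := by linarith
  have hneg : ∀ k : ℕ, segTL h (-(k : ℤ) - 1) = 0 := by
    intro k
    induction k with
    | zero =>
      have e0 := segTL_pred_sub h 0
      rw [if_neg (by norm_num), if_pos rfl, show (0 : ℤ) - 1 = -((0 : ℕ) : ℤ) - 1 by omega] at e0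
      linarith
    | succ k ih =>
      have ek := segTL_pred_sub h (-(k : ℤ) - 1)
      rw [if_neg (by omega), if_neg (by omega), show (-(k : ℤ) - 1 - 1) = -((k + 1 : ℕ) : ℤ) - 1 by omega] at ek
      linarith
  rcases lt_trichotomy j 0 with hj | rfl | hj
  · obtain ⟨k, hk⟩ : ∃ k : ℕ, j = -(k : ℤ) - 1 := ⟨(-j - 1).toNat, by omega⟩
    rw [hk, hneg k, if_neg (by omega)]
  · rw [h0, if_pos rfl]
  · rw [if_neg (by omega)]
    rcases eq_or_lt_of_le (show (1 : ℤ) ≤ j by omega) with hj' | hj'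
    · rw [← hj']; exact h1
    · exact htwo j (by omega)

/-! ## §4 Supports and bounds -/

/-- `|τ_L| ≤ 18/n`. [folklore] -/
theorem abs_tauL_le (s : ℤ) : |tauL h s| ≤ 18 / side h := by
  unfold tauL
  rw [abs_mul, abs_inv, abs_of_pos (side_real_pos h), div_eq_inv_mul]
  exact mul_le_mul_of_nonneg_left (abs_rhoL_le h _) (inv_nonneg.mpr (side_real_pos h).le)

/-- `τ_L` is supported in `[h − 2p, h + 2p] ⊂ (0, n)`. [folklore] -/
theorem tauL_eq_zero {s : ℤ} (hs : s < (h : ℤ) - 2 * prad h ∨ (h : ℤ) + 2 * prad h < s) : tauL h s = 0 := by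
  unfold tauL; rw [rhoL_eq_zero h (by omega), mul_zero]

/-- `|σ_L| ≤ 18`. [folklore] -/
theorem abs_sigmaL_le (s : ℤ) : |sigmaL h s| ≤ 18 := by
  unfold sigmaL
  rw [abs_mul, abs_inv, abs_of_pos (side_real_pos h)]
  have hb : ∑ u ∈ rsupp h, |rhoL h u * box h (s - u)| ≤ ∑ _u ∈ rsupp h, (18 : ℝ) := by
    refine sum_le_sum fun u _ => ?_
    rw [abs_mul]
    have hbox : |box h (s - u)| ≤ 1 := by unfold LinearLiftProfile.box; split_ifs <;> simp
    calc |rhoL h u| * |box h (s - u)| ≤ 18 * 1 := mul_le_mul (abs_rhoL_le h u) hbox (abs_nonneg _) (by norm_num)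
      _ = 18 := mul_one _
  have hcard : ∑ _u ∈ rsupp h, (18 : ℝ) = 18 * (4 * (prad h : ℝ) + 1) := by
    rw [sum_const, nsmul_eq_mul]
    have e := sum_rsupp_one h
    rw [sum_const, nsmul_eq_mul, mul_one] at e
    rw [e]; ring
  have h4 : 4 * (prad h : ℝ) + 1 ≤ side h := by exact_mod_cast four_prad_succ_le h
  have hi := inv_nonneg.mpr (side_real_pos h).le
  calc (side h : ℝ)⁻¹ * |∑ u ∈ rsupp h, rhoL h u * box h (s - u)| ≤ (side h : ℝ)⁻¹ * ∑ u ∈ rsupp h, |rhoL h u * box h (s - u)| :=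
        mul_le_mul_of_nonneg_left (abs_sum_le_sum_abs _ _) hi
    _ ≤ (side h : ℝ)⁻¹ * (18 * side h) := by
        refine mul_le_mul_of_nonneg_left (hb.trans ?_) hi
        rw [hcard]; nlinarith
    _ = 18 := by rw [mul_comm, mul_assoc, mul_inv_cancel₀ (side_real_pos h).ne', mul_one]

/-- `σ_L` is supported in `[−h − 2p, h + 2p] ⊂ (−n, n)`. [folklore] -/
theorem sigmaL_eq_zero {s : ℤ} (hs : s < -((h : ℤ) + 2 * prad h) ∨ (h : ℤ) + 2 * prad h < s) : sigmaL h s = 0 := by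
  unfold sigmaL
  rw [sum_eq_zero, mul_zero]
  intro u hu
  rw [mem_rsupp] at hu
  unfold LinearLiftProfile.box
  rw [if_neg (by omega), mul_zero]

/-- `|σ_L(s+1) − σ_L(s)| ≤ 36/n`. [folklore] -/
theorem abs_sigmaL_succ_sub_le (s : ℤ) : |sigmaL h (s + 1) - sigmaL h s| ≤ 36 / side h := by
  rw [sigmaL_succ_sub]
  calc |tauL h (s + side h) - tauL h s| ≤ |tauL h (s + side h)| + |tauL h s| := abs_sub _ _
    _ ≤ 18 / side h + 18 / side h := add_le_add (abs_tauL_le h _) (abs_tauL_le h _)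
    _ = 36 / side h := by ring


/-- **★ (vi) THE LIPSCHITZ ROW OF THE 1-FORM PROFILE**: `|τ_L(s+1) − τ_L(s)| ≤ 110/n²` — one power of `n` better than the sup bound, which is what turns the spread coarse curl
into a fine curl that is LIPSCHITZ at scale `n` (`|∂*curl| ≤ C·ε/n³`, the divergence clause of `RegPr`). [folklore] -/
theorem abs_tauL_succ_sub_le (s : ℤ) : |tauL h (s + 1) - tauL h s| ≤ 110 / (side h : ℝ) ^ 2 := by
  unfold tauL
  rw [← mul_sub, abs_mul, abs_inv, abs_of_pos (side_real_pos h), show s + 1 - (h : ℤ) = s - (h : ℤ) + 1 by ring]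
  have hn := side_real_pos h
  calc (side h : ℝ)⁻¹ * |rhoL h (s - (h : ℤ) + 1) - rhoL h (s - (h : ℤ))| ≤ (side h : ℝ)⁻¹ * (110 / side h) :=
        mul_le_mul_of_nonneg_left (abs_rhoL_succ_sub_le h _) (inv_nonneg.mpr hn.le)
    _ = 110 / (side h : ℝ) ^ 2 := by field_simp

end Summit.QuantumFields.YangMills.Theorems.LinearLiftProfileLip

end
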